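import Literature.Analysis.UnboundedOperators.HeatDuhamelSliceRegularity
import HarnessLib

/-!
# Slice Duhamel integrals of `C^{n,γ}` data are `C^{n+2}`, with quantitative bounds

Analysis/UnboundedOperators support file (everything proved; no definitions, no named facts),
sequel to `HeatDuhamelSliceRegularity.lean`, written for the all-orders bootstrap in the proof of
the named fact `Literature.Analysis.FluidPDE.jia_sverak_2014_local_higher_regularity` (Jia–Šverák
2014, §3 Thm 3.2 and p. 9). It packages the engine of that file into the single statement consumed
at every level of the bootstrap:

* `exists_duhamel_level_bounds` — for `n` and `0 < γ < 1` there is `C = C(n, γ, dim E)` such that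
  for every Banach `F`, every strongly measurable family `g : ℝ → E → F` of `Cⁿ` slices with
  `‖Dᵏg(s)‖ ≤ M` (`k ≤ n`) and `‖Dⁿg(s)(y) - Dⁿg(s)(z)‖ ≤ M ‖y - z‖^γ`, and every `0 < t ≤ 1`, the
  Duhamel integral `J = ∫_{(0,t)} e^{(t-s)Δ}g(s) ds` is `C^{n+2}` with `‖DᵏJ‖ ≤ C M` (`k ≤ n + 2`)
  and `‖Dⁿ⁺²J(x) - Dⁿ⁺²J(y)‖ ≤ C M ‖x - y‖^γ` — the gain of (almost) two derivatives of the heat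
  Duhamel integral on `C^{n,γ}` data (`DᵏJ = J[Dᵏg]` for `k ≤ n`; then one and two derivatives
  under the integral on the Hölder data `Dⁿg`; smoothness through
  `contDiff_iff_continuous_differentiable`).

## References

* H. Jia, V. Šverák, Invent. Math. 196 (2014) = arXiv:1204.0529, §3 (p. 9). Bib key
  `JiaSverak2014`.
* Y. Giga, M.-H. Giga, J. Saal, *Nonlinear PDEs* (2010), §1.1.3. Bib key `GigaGigaSaal2010`.
-/

noncomputable section

open MeasureTheory Set Function Filter Metric InnerProductSpace
open _root_.Topology
open scoped ENNReal NNReal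

namespace Literature.Analysis.UnboundedOperators

namespace HeatHolder

-- nested operator types
set_option maxSynthPendingDepth 3

variable {E : Type} [NormedAddCommGroup E] [InnerProductSpace ℝ E] [FiniteDimensional ℝ E]
  [MeasurableSpace E] [BorelSpace E]

set_option maxHeartbeats 1600000 in
/-- **The level bounds of the Duhamel integral.** For `n` and `0 < γ < 1` there is `C = C(n, γ, d)`
such that: for every Banach `F` and every strongly measurable family `g : ℝ → E → F` of `Cⁿ` slices
with `‖Dᵏg(s)‖ ≤ M` (`k ≤ n`) and `‖Dⁿg(s)(y) - Dⁿg(s)(z)‖ ≤ M‖y - z‖^γ` for all `s`, and every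
`0 < t ≤ 1`, the Duhamel integral `J(x) = ∫_{(0,t)} e^{(t-s)Δ}g(s)(x) ds` is `C^{n+2}` with
`‖DᵏJ‖ ≤ C M` for `k ≤ n + 2` and `‖Dⁿ⁺²J(x) - Dⁿ⁺²J(y)‖ ≤ C M ‖x - y‖^γ`
(`Dᵏ J = J[Dᵏg]` for `k ≤ n`, then one and two derivatives under the integral on the `C^{0,γ}`
data `Dⁿg`, `HeatDuhamelSliceRegularity.lean`). [folklore] -/
theorem exists_duhamel_level_bounds (n : ℕ) {γ : ℝ} (hγ0 : 0 < γ) (hγ1 : γ < 1) :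
    ∃ C : ℝ, 0 ≤ C ∧ ∀ {F : Type} [NormedAddCommGroup F] [NormedSpace ℝ F] [CompleteSpace F]
      {g : ℝ → E → F} {M : ℝ}, 0 ≤ M → StronglyMeasurable (uncurry g) →
      (∀ s, ContDiff ℝ n (g s)) →
      (∀ s, ∀ k ≤ n, ∀ y, ‖iteratedFDeriv ℝ k (g s) y‖ ≤ M) →
      (∀ s y z, ‖iteratedFDeriv ℝ n (g s) y - iteratedFDeriv ℝ n (g s) z‖ ≤ M * ‖y - z‖ ^ γ) →
      ∀ {t : ℝ}, 0 < t → t ≤ 1 →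
        ContDiff ℝ (n + 2) (fun x => ∫ s in Ioo 0 t, heatExtension (g s) (t - s) x) ∧
        (∀ k ≤ n + 2, ∀ x, ‖iteratedFDeriv ℝ k (fun x => ∫ s in Ioo 0 t, heatExtension (g s) (t - s) x) x‖ ≤ C * M) ∧
        ∀ x y, ‖iteratedFDeriv ℝ (n + 2) (fun x => ∫ s in Ioo 0 t, heatExtension (g s) (t - s) x) x -
          iteratedFDeriv ℝ (n + 2) (fun x => ∫ s in Ioo 0 t, heatExtension (g s) (t - s) x) y‖ ≤ C * M * ‖x - y‖ ^ γ := by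
  -- the constants of the engine
  set c : ℝ := (2 : ℝ) ^ ((Module.finrank ℝ E : ℝ) / 2) with hc
  set K₂ : ℝ := 4 * c * (2 * c * (1 + 2 * c)) with hK₂
  set K₃ : ℝ := 4 * c * K₂ with hK₃
  have hc0 : 0 ≤ c := by positivity
  have hK₂0 : 0 ≤ K₂ := by positivity
  have hK₃0 : 0 ≤ K₃ := by positivity
  set C : ℝ := 1 + 2 * c + K₂ * (2 / γ) + ((4 / γ) * K₂ + (2 / (1 - γ)) * K₃) with hC
  have h1γ : 0 < 1 - γ := by linarith
  have hC0 : 0 ≤ C := by positivity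
  refine ⟨C, hC0, ?_⟩
  intro F _ _ _ g M hM hgm hgn hgb hgH t ht ht1
  -- the data `Dⁿg`: strongly measurable family of bounded continuous Hölder slices
  set G : ℝ → E → E [×n]→L[ℝ] F := fun s => iteratedFDeriv ℝ n (g s) with hG
  have hGm : StronglyMeasurable (uncurry G) := stronglyMeasurable_iteratedFDeriv_family hgm hgn n le_rfl
  have hGc : ∀ s, Continuous (G s) := fun s => (hgn s).continuous_iteratedFDeriv le_rfl
  have hGb : ∀ s y, ‖G s y‖ ≤ M := fun s y => hgb s n le_rfl y
  have hGH : ∀ s y z, ‖G s y - G s z‖ ≤ M * ‖y - z‖ ^ γ := hgH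
  -- the Duhamel integrals of `g` and of `Dⁿg`
  set J : E → F := fun x => ∫ s in Ioo 0 t, heatExtension (g s) (t - s) x with hJ
  set Jn : E → E [×n]→L[ℝ] F := fun x => ∫ s in Ioo 0 t, heatExtension (G s) (t - s) x with hJn
  -- `Dᵏ J = J[Dᵏg]` for `k ≤ n`
  have hDk : ∀ k ≤ n, iteratedFDeriv ℝ k J = fun x => ∫ s in Ioo 0 t, heatExtension (iteratedFDeriv ℝ k (g s)) (t - s) x :=
    fun k hk => iteratedFDeriv_duhamel_eq hgm hgn (Cj := fun _ => M) (fun j hj s y => hgb s j hj y) t k hk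
  have hDn : iteratedFDeriv ℝ n J = Jn := hDk n le_rfl
  -- first and second derivatives of `Jn`
  have hJn1 : ∀ x, HasFDerivAt Jn (∫ s in Ioo 0 t, fderiv ℝ (heatExtension (G s) (t - s)) x) x := fun x =>
    hasFDerivAt_duhamel hGm hGc hGb t x
  have hJn1' : fderiv ℝ Jn = fun x => ∫ s in Ioo 0 t, fderiv ℝ (heatExtension (G s) (t - s)) x :=
    funext fun x => (hJn1 x).fderiv
  have hJn2 : ∀ x, HasFDerivAt (fderiv ℝ Jn) (∫ s in Ioo 0 t, fderiv ℝ (fderiv ℝ (heatExtension (G s) (t - s))) x) x := by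
    intro x
    rw [hJn1']
    exact hasFDerivAt_fderiv_duhamel hGm hGc hGb hM hγ0 hγ1.le hGH t x
  have hJn2' : fderiv ℝ (fderiv ℝ Jn) = fun x => ∫ s in Ioo 0 t, fderiv ℝ (fderiv ℝ (heatExtension (G s) (t - s))) x :=
    funext fun x => (hJn2 x).fderiv
  -- the currying isometries
  set L₁ := (continuousMultilinearCurryLeftEquiv ℝ (fun _ : Fin (n + 1) => E) F).symm with hL₁
  set L₂ := (continuousMultilinearCurryLeftEquiv ℝ (fun _ : Fin (n + 2) => E) F).symm with hL₂
  have hDn1 : iteratedFDeriv ℝ (n + 1) J = fun x => L₁ (fderiv ℝ Jn x) := by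
    rw [iteratedFDeriv_succ_eq_comp_left, hDn]; rfl
  -- `fderiv (L₁ ∘ fderiv Jn) = L₁ ∘L fderiv (fderiv Jn)`
  have hDn1d : ∀ x, HasFDerivAt (iteratedFDeriv ℝ (n + 1) J)
      ((L₁ : (E →L[ℝ] E [×n]→L[ℝ] F) →L[ℝ] E [×(n + 1)]→L[ℝ] F).comp
        (∫ s in Ioo 0 t, fderiv ℝ (fderiv ℝ (heatExtension (G s) (t - s))) x)) x := by
    intro x
    rw [hDn1]
    exact (L₁ : (E →L[ℝ] E [×n]→L[ℝ] F) →L[ℝ] E [×(n + 1)]→L[ℝ] F).hasFDerivAt.comp x (hJn2 x)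
  have hDn2 : ∀ x, iteratedFDeriv ℝ (n + 2) J x =
      L₂ (((L₁ : (E →L[ℝ] E [×n]→L[ℝ] F) →L[ℝ] E [×(n + 1)]→L[ℝ] F)).comp
        (∫ s in Ioo 0 t, fderiv ℝ (fderiv ℝ (heatExtension (G s) (t - s))) x)) := by
    intro x
    rw [iteratedFDeriv_succ_eq_comp_left, Function.comp_apply, (hDn1d x).fderiv]
  /- ### the bounds -/
  -- `k ≤ n`
  have Bk : ∀ k ≤ n, ∀ x, ‖iteratedFDeriv ℝ k J x‖ ≤ M := by
    intro k hk x
    rw [hDk k hk]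
    have h := norm_duhamel_le (g := fun s => iteratedFDeriv ℝ k (g s)) (fun s y => hgb s k hk y) ht.le x
    have hMt : M * t ≤ M := by
      calc M * t ≤ M * 1 := mul_le_mul_of_nonneg_left ht1 hM
        _ = M := mul_one _
    exact h.trans hMt
  -- `k = n + 1`
  have Bn1 : ∀ x, ‖iteratedFDeriv ℝ (n + 1) J x‖ ≤ 2 * c * M := by
    intro x
    rw [hDn1]
    simp only [LinearIsometryEquiv.norm_map]
    have h := norm_fderiv_duhamel_le hGm hGc hGb ht x
    have ht' : t ^ (1 / 2 : ℝ) ≤ 1 := Real.rpow_le_one ht.le ht1 (by norm_num)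
    calc ‖fderiv ℝ Jn x‖ ≤ 2 * c * M * t ^ (1 / 2 : ℝ) := h
      _ ≤ 2 * c * M * 1 := mul_le_mul_of_nonneg_left ht' (by positivity)
      _ = 2 * c * M := mul_one _
  -- `k = n + 2`
  have Bn2 : ∀ x, ‖iteratedFDeriv ℝ (n + 2) J x‖ ≤ K₂ * (2 / γ) * M := by
    intro x
    rw [hDn2 x, LinearIsometryEquiv.norm_map]
    have h := norm_fderiv_fderiv_duhamel_le hGc hGb hM hγ0 hγ1.le hGH ht x
    have ht' : t ^ (γ / 2) ≤ 1 := Real.rpow_le_one ht.le ht1 (by positivity)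
    calc ‖((L₁ : (E →L[ℝ] E [×n]→L[ℝ] F) →L[ℝ] E [×(n + 1)]→L[ℝ] F)).comp
          (∫ s in Ioo 0 t, fderiv ℝ (fderiv ℝ (heatExtension (G s) (t - s))) x)‖
        ≤ ‖(L₁ : (E →L[ℝ] E [×n]→L[ℝ] F) →L[ℝ] E [×(n + 1)]→L[ℝ] F)‖ *
            ‖∫ s in Ioo 0 t, fderiv ℝ (fderiv ℝ (heatExtension (G s) (t - s))) x‖ := ContinuousLinearMap.opNorm_comp_le _ _
      _ ≤ 1 * (K₂ * M * (2 / γ) * t ^ (γ / 2)) := by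
          refine mul_le_mul ?_ h (norm_nonneg _) zero_le_one
          exact L₁.toContinuousLinearEquiv.toContinuousLinearMap.opNorm_le_bound zero_le_one fun v => by
            rw [one_mul]; exact le_of_eq (L₁.norm_map v)
      _ ≤ K₂ * (2 / γ) * M := by
          rw [one_mul]
          calc K₂ * M * (2 / γ) * t ^ (γ / 2) ≤ K₂ * M * (2 / γ) * 1 :=
                mul_le_mul_of_nonneg_left ht' (by positivity)
            _ = K₂ * (2 / γ) * M := by ring
  -- Hölder bound of `Dⁿ⁺²J`
  have Hn2 : ∀ x y, ‖iteratedFDeriv ℝ (n + 2) J x - iteratedFDeriv ℝ (n + 2) J y‖ ≤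
      ((4 / γ) * K₂ + (2 / (1 - γ)) * K₃) * M * ‖x - y‖ ^ γ := by
    intro x y
    rw [hDn2 x, hDn2 y, ← map_sub, LinearIsometryEquiv.norm_map, ← ContinuousLinearMap.comp_sub]
    have h := norm_fderiv_fderiv_duhamel_sub_le hGm hGc hGb hM hγ0 hγ1 hGH ht x y
    calc ‖((L₁ : (E →L[ℝ] E [×n]→L[ℝ] F) →L[ℝ] E [×(n + 1)]→L[ℝ] F)).comp
          ((∫ s in Ioo 0 t, fderiv ℝ (fderiv ℝ (heatExtension (G s) (t - s))) x) -
            ∫ s in Ioo 0 t, fderiv ℝ (fderiv ℝ (heatExtension (G s) (t - s))) y)‖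
        ≤ ‖(L₁ : (E →L[ℝ] E [×n]→L[ℝ] F) →L[ℝ] E [×(n + 1)]→L[ℝ] F)‖ *
            ‖(∫ s in Ioo 0 t, fderiv ℝ (fderiv ℝ (heatExtension (G s) (t - s))) x) -
              ∫ s in Ioo 0 t, fderiv ℝ (fderiv ℝ (heatExtension (G s) (t - s))) y‖ := ContinuousLinearMap.opNorm_comp_le _ _
      _ ≤ 1 * (((4 / γ) * K₂ + (2 / (1 - γ)) * K₃) * M * ‖x - y‖ ^ γ) := by
          refine mul_le_mul ?_ h (norm_nonneg _) zero_le_one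
          exact L₁.toContinuousLinearEquiv.toContinuousLinearMap.opNorm_le_bound zero_le_one fun v => by
            rw [one_mul]; exact le_of_eq (L₁.norm_map v)
      _ = _ := one_mul _
  /- ### smoothness -/
  have hsmooth : ContDiff ℝ ((n + 2 : ℕ) : ℕ∞) J := by
    refine contDiff_iff_continuous_differentiable.2 ⟨fun m hm => ?_, fun m hm => ?_⟩
    · -- continuity of `Dᵐ J`, `m ≤ n + 2`
      have hm' : m ≤ n + 2 := by exact_mod_cast hm
      rcases Nat.lt_or_ge m (n + 2) with hlt | hge
      · -- differentiable, hence continuous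
        rcases Nat.lt_or_ge m (n + 1) with hlt' | hge'
        · have hmn : m ≤ n := by omega
          rw [hDk m hmn]
          have hgm' : StronglyMeasurable (uncurry fun s y => iteratedFDeriv ℝ m (g s) y) :=
            stronglyMeasurable_iteratedFDeriv_family hgm hgn m hmn
          exact continuous_iff_continuousAt.2 fun x => (hasFDerivAt_duhamel hgm'
            (fun s => (hgn s).continuous_iteratedFDeriv (by exact_mod_cast hmn)) (fun s y => hgb s m hmn y) t x).continuousAt
        · have hm1 : m = n + 1 := by omega
          subst hm1
          exact continuous_iff_continuousAt.2 fun x => (hDn1d x).continuousAt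
      · have hm2 : m = n + 2 := by omega
        subst hm2
        -- Hölder continuous
        have hHc : 0 ≤ ((4 / γ) * K₂ + (2 / (1 - γ)) * K₃) * M := by positivity
        refine continuous_iff_continuousAt.2 fun x => ?_
        rw [ContinuousAt, tendsto_iff_norm_sub_tendsto_zero]
        have hlim : Tendsto (fun y => ((4 / γ) * K₂ + (2 / (1 - γ)) * K₃) * M * ‖y - x‖ ^ γ) (𝓝 x) (𝓝 0) := by
          have h1 : Tendsto (fun y : E => ‖y - x‖) (𝓝 x) (𝓝 0) := by
            have hc' : Continuous fun y : E => ‖y - x‖ := (continuous_id.sub continuous_const).norm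
            have h := hc'.tendsto x
            simp only [sub_self, norm_zero] at h
            exact h
          have h2 : Tendsto (fun y : E => ‖y - x‖ ^ γ) (𝓝 x) (𝓝 0) := by
            have := h1.rpow_const (p := γ) (Or.inr hγ0.le)
            rwa [Real.zero_rpow hγ0.ne'] at this
          simpa using h2.const_mul (((4 / γ) * K₂ + (2 / (1 - γ)) * K₃) * M)
        refine squeeze_zero (fun y => norm_nonneg _) (fun y => ?_) hlim
        exact Hn2 y x
    · -- differentiability of `Dᵐ J`, `m < n + 2`
      have hm' : m < n + 2 := by exact_mod_cast hm
      rcases Nat.lt_or_ge m (n + 1) with hlt' | hge'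
      · have hmn : m ≤ n := by omega
        rw [hDk m hmn]
        have hgm' : StronglyMeasurable (uncurry fun s y => iteratedFDeriv ℝ m (g s) y) :=
          stronglyMeasurable_iteratedFDeriv_family hgm hgn m hmn
        exact fun x => (hasFDerivAt_duhamel hgm' (fun s => (hgn s).continuous_iteratedFDeriv (by exact_mod_cast hmn))
          (fun s y => hgb s m hmn y) t x).differentiableAt
      · have hm1 : m = n + 1 := by omega
        subst hm1
        exact fun x => (hDn1d x).differentiableAt
  have hC1 : 1 ≤ C := by
    rw [hC]
    have : 0 ≤ 2 * c + K₂ * (2 / γ) + ((4 / γ) * K₂ + (2 / (1 - γ)) * K₃) := by positivity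
    linarith
  refine ⟨by exact_mod_cast hsmooth, fun k hk x => ?_, fun x y => ?_⟩
  · rcases Nat.lt_or_ge k (n + 1) with hlt | hge
    · have hkn : k ≤ n := by omega
      calc ‖iteratedFDeriv ℝ k J x‖ ≤ M := Bk k hkn x
        _ ≤ C * M := le_mul_of_one_le_left hM hC1
    · rcases Nat.lt_or_ge k (n + 2) with hlt' | hge'
      · have hk1 : k = n + 1 := by omega
        subst hk1
        calc ‖iteratedFDeriv ℝ (n + 1) J x‖ ≤ 2 * c * M := Bn1 x
          _ ≤ C * M := by
              refine mul_le_mul_of_nonneg_right ?_ hM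
              rw [hC]
              have : 0 ≤ K₂ * (2 / γ) + ((4 / γ) * K₂ + (2 / (1 - γ)) * K₃) := by positivity
              linarith
      · have hk2 : k = n + 2 := by omega
        subst hk2
        calc ‖iteratedFDeriv ℝ (n + 2) J x‖ ≤ K₂ * (2 / γ) * M := Bn2 x
          _ ≤ C * M := by
              refine mul_le_mul_of_nonneg_right ?_ hM
              rw [hC]
              have : 0 ≤ ((4 / γ) * K₂ + (2 / (1 - γ)) * K₃) := by positivity
              linarith
  · calc ‖iteratedFDeriv ℝ (n + 2) J x - iteratedFDeriv ℝ (n + 2) J y‖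
        ≤ ((4 / γ) * K₂ + (2 / (1 - γ)) * K₃) * M * ‖x - y‖ ^ γ := Hn2 x y
      _ ≤ C * M * ‖x - y‖ ^ γ := by
          refine mul_le_mul_of_nonneg_right (mul_le_mul_of_nonneg_right ?_ hM) (Real.rpow_nonneg (norm_nonneg _) _)
          rw [hC]
          have : 0 ≤ K₂ * (2 / γ) := by positivity
          linarith

end HeatHolder

end Literature.Analysis.UnboundedOperators
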